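import Literature.NumberTheory.GaloisRepresentations.ProcyclicCdOne
import HarnessLib

/-!
# A pro-(cyclic `p`-group) is procyclic with a topological generator; hence `cd_p ≤ 1`
# (Serre CG I §3.4, §4.1)

Topic `NumberTheory/GaloisRepresentations`; namespace `Literature.NumberTheory.GaloisRepresentations`.
Theorems only (no definition, no named fact; D-0026).

Let `Q` be a profinite group (compact, totally disconnected topological group) all of whose finite
quotients `Q/H` (`H` open normal) are CYCLIC `p`-GROUPS, and which has open normal subgroups of
arbitrarily large index (i.e. `Q` is infinite).  The model is `Q ≅ ℤ_p` — any infinite closed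
subgroup of `1 + pℤ_p ⊂ ℤ_pˣ`, e.g. the Galois group of the cyclotomic `ℤ_p`-extension of a number
field.  We prove, by finite group theory only:

* `zpowers_eq_top_of_map_of_isCyclic_pGroup` — **lifting generators**: for a surjection
  `f : C → C'` of a finite cyclic `p`-group onto a non-trivial group, `x` generates `C` as soon as
  `f x` generates `C'` (a proper subgroup of `C` consists of `p`-th powers, and the `p`-th powers of
  `C'` form a proper subgroup);
* `exists_topologicalGenerator_of_isCyclic_pGroup` — **`Q` has a topological generator `φ`**
  (its image generates every `Q/H`) **whose open normal subgroups go arbitrarily deep in the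
  `p`-direction** (for every open normal `H₀` and `s` an open normal `H₁ ≤ H₀` with
  `φ^i ∈ H₁ ⟹ p^s · ord(φ̄ mod H₀) ∣ i`) — exactly the hypotheses `hgen`, `hdepth` of
  `groupCdLE_one_of_procyclic` (`ProcyclicCdOne.lean`);
* `groupCdLE_one_of_isCyclic_pGroup` — **`cd_p(Q) ≤ 1`** for such `Q`.

Consumer: `cd_p(Gal(k·ℚ_∞/k)) ≤ 1` in Serre II §4.4 Prop. 13 (`cd_p(G_k) ≤ 2`, the tree's named
fact `fieldCdLE_two_of_numberField`), where `Gal(k·ℚ_∞/k)` embeds in `1 + pℤ_p` (resp. `1 + 4ℤ_2`)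
via a power of the cyclotomic character, so that its finite quotients are cyclic `p`-groups.

## References

* J.-P. Serre, *Cohomologie galoisienne* / *Galois Cohomology* (1997), I §3.4, I §4.1, II §4.4
  Prop. 13 (proof, Lemme 1). [SerreGaloisCohomology1997]
-/

noncomputable section

open CategoryTheory Function
open _root_.Topology _root_.Filter

universe u

namespace Literature.NumberTheory.GaloisRepresentations

/-! ### Finite cyclic `p`-groups: lifting generators along surjections -/

section Finite

variable {C C' : Type*} [Group C] [Group C'] [Finite C]

/-- In a finite `p`-group, an element which is a `p`-th power has order `< #G` unless `G` is
trivial: if `g = z ^ p` generates the cyclic group `C'` of order `p^c`, `c ≥ 1`, then `ord z` would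
exceed `#C'`. Concretely: **a generator of a non-trivial finite cyclic `p`-group is not a `p`-th
power**. [folklore] -/
private theorem not_isCyclic_generator_pow {p : ℕ} [hp : Fact p.Prime] [Finite C'] (hC' : IsPGroup p C')
    [Nontrivial C'] {g : C'} (hg : ∀ y : C', y ∈ Subgroup.zpowers g) (z : C') : z ^ p ≠ g := by
  intro hz
  have hord : orderOf g = Nat.card C' := orderOf_eq_card_of_forall_mem_zpowers hg
  obtain ⟨t, ht⟩ := hC' z
  -- `orderOf z = p ^ t'` for some `t'`
  obtain ⟨t', -, ht'⟩ := (Nat.dvd_prime_pow hp.out).1 (orderOf_dvd_of_pow_eq_one ht)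
  rcases Nat.eq_zero_or_pos t' with h0 | hpos
  · -- `z = 1`, so `g = 1`, contradicting non-triviality
    rw [h0, pow_zero, orderOf_eq_one_iff] at ht'
    rw [ht', one_pow] at hz
    have h1 : Nat.card C' = 1 := by rw [← hord, ← hz, orderOf_one]
    exact (Finite.one_lt_card (α := C')).ne' h1
  · -- `orderOf (z ^ p) = p ^ (t' - 1) < p ^ t' ≤ #C'`
    have h1 : orderOf (z ^ p) = p ^ (t' - 1) := by
      rw [orderOf_pow' z hp.out.ne_zero, ht', Nat.gcd_eq_right (dvd_pow_self p hpos.ne')]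
      exact Nat.div_eq_of_eq_mul_left hp.out.pos (by rw [← pow_succ, Nat.sub_add_cancel hpos])
    have h2 : orderOf z ≤ Nat.card C' := Nat.le_of_dvd Nat.card_pos (orderOf_dvd_natCard z)
    have h3 : p ^ (t' - 1) < p ^ t' := Nat.pow_lt_pow_right hp.out.one_lt (Nat.sub_lt hpos one_pos)
    rw [hz, hord] at h1
    rw [ht'] at h2
    omega

/-- **Lifting generators in cyclic `p`-groups**: let `C` be a finite cyclic `p`-group, `f : C → C'`
a surjective homomorphism onto a NON-TRIVIAL group, and `x ∈ C` with `f x` generating `C'`. Then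
`x` generates `C`. (Write `x = g^m` for a generator `g`; if `p ∣ m` then `f x = (f g^{m/p})^p` is a
`p`-th power generating `C'`, impossible by `not_isCyclic_generator_pow`; so `p ∤ m`,
`gcd(m, #C) = 1` and `x` generates.) [cite: SerreGaloisCohomology1997, I §4.1 (pro-`p`-groups)] -/
theorem zpowers_eq_top_of_map_of_isCyclic_pGroup {p : ℕ} [hp : Fact p.Prime] [IsCyclic C]
    (hC : IsPGroup p C) (f : C →* C') (hf : Function.Surjective f) [Nontrivial C']
    {x : C} (hx : ∀ y : C', y ∈ Subgroup.zpowers (f x)) : ∀ y : C, y ∈ Subgroup.zpowers x := by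
  classical
  haveI : Finite C' := Finite.of_surjective f hf
  have hC' : IsPGroup p C' := hC.of_surjective f hf
  obtain ⟨g, hg⟩ := IsCyclic.exists_generator (α := C)
  obtain ⟨m, rfl⟩ : x ∈ Submonoid.powers g := (mem_powers_iff_mem_zpowers).2 (hg x)
  -- `p ∤ m`
  have hpm : ¬ p ∣ m := by
    rintro ⟨m', rfl⟩
    have h1 : f (g ^ (p * m')) = (f (g ^ m')) ^ p := by rw [mul_comm, pow_mul, map_pow]
    exact not_isCyclic_generator_pow hC' hx (f (g ^ m')) h1.symm
  -- hence `g ^ m` has full order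
  obtain ⟨c, hc⟩ := (IsPGroup.iff_card).1 hC
  have hordg : orderOf g = Nat.card C := orderOf_eq_card_of_forall_mem_zpowers hg
  have hcop : (orderOf g).Coprime m := by
    rw [hordg, hc]
    exact (Nat.Coprime.pow_left c ((Nat.Prime.coprime_iff_not_dvd hp.out).2 hpm))
  have hord : orderOf (g ^ m) = Nat.card C := by rw [hcop.orderOf_pow, hordg]
  have htop : Subgroup.zpowers (g ^ m) = ⊤ :=
    Subgroup.eq_top_of_card_eq _ (by rw [Nat.card_zpowers, hord])
  intro y
  rw [htop]
  exact Subgroup.mem_top y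

end Finite

/-! ### Profinite groups whose finite quotients are cyclic `p`-groups -/

section Profinite

variable {Q : Type u} [Group Q] [TopologicalSpace Q] [IsTopologicalGroup Q] [CompactSpace Q]
  [TotallyDisconnectedSpace Q]

omit [TotallyDisconnectedSpace Q] in
/-- **A pro-(cyclic `p`-group) with open subgroups of unbounded index has a topological generator
with `p`-deep open normal subgroups.**  Let every finite quotient `Q/H` (`H` open normal) be a
cyclic `p`-group and let `Q` have open normal subgroups of arbitrarily large index. Then there is
`φ ∈ Q` such that (i) the image of `φ` generates every `Q/H`, and (ii) for every open normal `H₀`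
and every `s` there is an open normal `H₁ ≤ H₀` with `φ^i ∈ H₁ ⟹ p^s · ord(φ̄ mod H₀) ∣ i`.
(Take `φ` lifting a generator of one non-trivial quotient `Q/H₀`; generators lift along
`Q/(H ∩ H₀) ↠ Q/H₀` (`zpowers_eq_top_of_map_of_isCyclic_pGroup`) and descend to `Q/H`; for (ii)
intersect `H₀` with an open normal subgroup of index `≥ p^s [Q : H₀]`: all indices are powers of `p`
and `ord(φ̄ mod H) = [Q : H]`.) [cite: SerreGaloisCohomology1997, I §3.4, I §4.1] -/
theorem exists_topologicalGenerator_of_isCyclic_pGroup {p : ℕ} [hp : Fact p.Prime]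
    (hcyc : ∀ (H : Subgroup Q) [H.Normal], IsOpen (H : Set Q) → IsCyclic (Q ⧸ H))
    (hpg : ∀ (H : Subgroup Q) [H.Normal], IsOpen (H : Set Q) → IsPGroup p (Q ⧸ H))
    (hinf : ∀ n : ℕ, ∃ H : Subgroup Q, H.Normal ∧ IsOpen (H : Set Q) ∧ n ≤ H.index) :
    ∃ φ : Q,
      (∀ (H : Subgroup Q) [H.Normal], IsOpen (H : Set Q) →
        ∀ q : Q ⧸ H, ∃ i : ℕ, q = (QuotientGroup.mk φ : Q ⧸ H) ^ i) ∧
      (∀ (H : Subgroup Q) [H.Normal], IsOpen (H : Set Q) → ∀ s : ℕ,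
        ∃ H' : Subgroup Q, H'.Normal ∧ IsOpen (H' : Set Q) ∧ H' ≤ H ∧
          ∀ i : ℕ, φ ^ i ∈ H' → p ^ s * orderOf (QuotientGroup.mk φ : Q ⧸ H) ∣ i) := by
  classical
  -- a non-trivial finite quotient `Q/H₀` and a lift `φ` of a generator
  obtain ⟨H₀, hH₀n, hH₀o, hH₀i⟩ := hinf 2
  haveI : H₀.Normal := hH₀n
  haveI : Finite (Q ⧸ H₀) := Subgroup.quotient_finite_of_isOpen H₀ hH₀o
  haveI : Nontrivial (Q ⧸ H₀) := by
    rw [← Finite.one_lt_card_iff_nontrivial, ← Subgroup.index_eq_card]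
    omega
  haveI := hcyc H₀ hH₀o
  obtain ⟨g₀, hg₀⟩ := IsCyclic.exists_generator (α := Q ⧸ H₀)
  obtain ⟨φ, hφ⟩ := QuotientGroup.mk_surjective g₀
  -- (i) `φ` generates every finite quotient
  have hgen : ∀ (H : Subgroup Q) [H.Normal], IsOpen (H : Set Q) →
      ∀ q : Q ⧸ H, ∃ i : ℕ, q = (QuotientGroup.mk φ : Q ⧸ H) ^ i := by
    intro H hHn hHo q
    -- the level `H' = H ⊓ H₀`
    let H' : Subgroup Q := H ⊓ H₀
    haveI : H'.Normal := inferInstance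
    have hH'o : IsOpen (H' : Set Q) := hHo.inter hH₀o
    haveI : Finite (Q ⧸ H') := Subgroup.quotient_finite_of_isOpen H' hH'o
    haveI := hcyc H' hH'o
    -- `Q/H' ↠ Q/H₀` maps `φ̄` to the generator `g₀`
    have hle₀ : H' ≤ H₀.comap (MonoidHom.id Q) := inf_le_right.trans (Subgroup.comap_id H₀).symm.le
    have hleH : H' ≤ H.comap (MonoidHom.id Q) := inf_le_left.trans (Subgroup.comap_id H).symm.le
    set f : Q ⧸ H' →* Q ⧸ H₀ := QuotientGroup.map H' H₀ (MonoidHom.id Q) hle₀ with hf_def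
    have hf : Function.Surjective f := fun y => by
      obtain ⟨x, rfl⟩ := QuotientGroup.mk_surjective y
      exact ⟨QuotientGroup.mk x, by rw [hf_def, QuotientGroup.map_mk, MonoidHom.id_apply]⟩
    have hfφ : f (QuotientGroup.mk φ) = g₀ := by
      rw [hf_def, QuotientGroup.map_mk, MonoidHom.id_apply, hφ]
    have hgen' : ∀ y : Q ⧸ H', y ∈ Subgroup.zpowers (QuotientGroup.mk φ : Q ⧸ H') :=
      zpowers_eq_top_of_map_of_isCyclic_pGroup (hpg H' hH'o) f hf (by rw [hfφ]; exact hg₀)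
    -- descend along `Q/H' ↠ Q/H`
    obtain ⟨x, rfl⟩ := QuotientGroup.mk_surjective q
    obtain ⟨i, hi⟩ : (QuotientGroup.mk x : Q ⧸ H') ∈ Submonoid.powers (QuotientGroup.mk φ : Q ⧸ H') :=
      (mem_powers_iff_mem_zpowers).2 (hgen' _)
    refine ⟨i, ?_⟩
    have hi' : (QuotientGroup.mk φ : Q ⧸ H') ^ i = QuotientGroup.mk x := hi
    have h2 := congrArg (QuotientGroup.map H' H (MonoidHom.id Q) hleH) hi'.symm
    rw [map_pow, QuotientGroup.map_mk, QuotientGroup.map_mk, MonoidHom.id_apply,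
      MonoidHom.id_apply] at h2
    exact h2
  refine ⟨φ, hgen, fun H hHn hHo s => ?_⟩
  -- (ii) depth: intersect with an open normal subgroup of index `≥ p ^ s * [Q : H]`
  haveI : Finite (Q ⧸ H) := Subgroup.quotient_finite_of_isOpen H hHo
  obtain ⟨H'', hH''n, hH''o, hH''i⟩ := hinf (p ^ s * H.index)
  haveI : H''.Normal := hH''n
  let H₁ : Subgroup Q := H ⊓ H''
  haveI : H₁.Normal := inferInstance
  have hH₁o : IsOpen (H₁ : Set Q) := hHo.inter hH''o
  haveI : Finite (Q ⧸ H₁) := Subgroup.quotient_finite_of_isOpen H₁ hH₁o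
  refine ⟨H₁, inferInstance, hH₁o, inf_le_left, fun i hi => ?_⟩
  -- orders of `φ̄` are the indices (it generates), and indices are powers of `p`
  have hordH : orderOf (QuotientGroup.mk φ : Q ⧸ H) = H.index := by
    rw [Subgroup.index_eq_card]
    exact orderOf_eq_card_of_forall_mem_zpowers fun y => by
      obtain ⟨j, hj⟩ := hgen H hHo y
      rw [hj]
      exact Subgroup.npow_mem_zpowers _ j
  have hordH₁ : orderOf (QuotientGroup.mk φ : Q ⧸ H₁) = H₁.index := by
    rw [Subgroup.index_eq_card]
    exact orderOf_eq_card_of_forall_mem_zpowers fun y => by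
      obtain ⟨j, hj⟩ := hgen H₁ hH₁o y
      rw [hj]
      exact Subgroup.npow_mem_zpowers _ j
  obtain ⟨b, hb⟩ := (IsPGroup.iff_card).1 (hpg H hHo)
  obtain ⟨c, hc⟩ := (IsPGroup.iff_card).1 (hpg H₁ hH₁o)
  rw [← Subgroup.index_eq_card] at hb hc
  -- `φ ^ i ∈ H₁` gives `[Q : H₁] ∣ i`
  have hdvd₁ : H₁.index ∣ i := by
    rw [← hordH₁]
    exact orderOf_dvd_of_pow_eq_one (by rw [← QuotientGroup.mk_pow, QuotientGroup.eq_one_iff]; exact hi)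
  -- `p ^ s * [Q : H] ≤ [Q : H''] ≤ [Q : H₁]`, all powers of `p`
  have hle : p ^ s * H.index ≤ H₁.index :=
    hH''i.trans (Nat.le_of_dvd (Nat.pos_of_ne_zero (by rw [hc]; exact pow_ne_zero c hp.out.ne_zero))
      (Subgroup.index_dvd_of_le inf_le_right))
  have hdvd₂ : p ^ s * H.index ∣ H₁.index := by
    rw [hb, hc, ← pow_add] at hle ⊢
    exact Nat.pow_dvd_pow p ((Nat.pow_le_pow_iff_right hp.out.one_lt).1 hle)
  rw [hordH]
  exact hdvd₂.trans hdvd₁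

/-- **`cd_p(Q) ≤ 1` for a profinite group all of whose finite quotients are cyclic `p`-groups and
which has open normal subgroups of unbounded index** (e.g. `Q ≅ ℤ_p`; Serre I §3.4:
`cd_p(ℤ_p) = 1`): `exists_topologicalGenerator_of_isCyclic_pGroup` feeds
`groupCdLE_one_of_procyclic`. [cite: SerreGaloisCohomology1997, I §3.4] -/
theorem groupCdLE_one_of_isCyclic_pGroup (p : ℕ) [Fact p.Prime]
    (hcyc : ∀ (H : Subgroup Q) [H.Normal], IsOpen (H : Set Q) → IsCyclic (Q ⧸ H))
    (hpg : ∀ (H : Subgroup Q) [H.Normal], IsOpen (H : Set Q) → IsPGroup p (Q ⧸ H))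
    (hinf : ∀ n : ℕ, ∃ H : Subgroup Q, H.Normal ∧ IsOpen (H : Set Q) ∧ n ≤ H.index) :
    GroupCdLE Q p 1 := by
  obtain ⟨φ, hgen, hdepth⟩ := exists_topologicalGenerator_of_isCyclic_pGroup (p := p) hcyc hpg hinf
  exact groupCdLE_one_of_procyclic φ hgen p hdepth

end Profinite

end Literature.NumberTheory.GaloisRepresentations

end
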